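import Summits.QuantumFields.YangMills.Theorems.BalabanUVNodesN15KingModelSlicesZeroOnCarrier
import Summits.QuantumFields.YangMills.Theorems.BalabanUVNodesN15KingModelFullPropagatorGradHolderSlice
import Literature.MathematicalPhysics.QuantumFieldTheory.King1986.PropagatorDerivHolderSupNorm
import HarnessLib

/-!
# BalabanUVNodes ∕ N15 — THE KING-MODEL RUNG, CURVED EDITION (PART Ρ-d): PROPOSITION 3.7's GRADIENT HÖLDER CLAUSE (3.65)₂ AT EACH FIXED `α ∈ (0, 1)` FOR
# KING's GENUINE SLICES ON ONE CARRIER — `|∂^η_μ𝒢_j(x, z) − ∂^η_μ𝒢_j(y, z)| ≤ C(α)·(|x−y|∕L^j)^α·e^{−δ₀(α)·min(|x−z|, |y−z|)∕L^j}` (slices `j ≥ 1`: part U-iv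
# `ksDSlice_holder_unif`; the finest slice `j = 0`: [Ba 4] (1.9) at `K = 1`, `fineOp_inv_deriv_holder_decay_unif`), read on the level-`k` fine torus
# (Track A, DAG node N15 = NE2; FAN-OUT v1.1 §N15 s3 «KING-MODEL RUNG … + the one-line statement of what the curved case adds»)

HONEST FRAMING.  Count-neutral kernel bookkeeping (cell `pub-ymgap`, seat `pub-ymgap-dag-n15-e` g17; `--supports stmt-QuantumFields-27366 --as helper` =
K3⁸ `SpineGivenEndpointR13SepCoPHV`).  TEMPLATE LITERATURE, `A = 0`: C. King's scalar U(1)-Higgs MODEL on finite tori ([King1986] Prop. 3.7 (3.65) p. 663, Thm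
3.3 (3.8) p. 656), NOT Bałaban's covariant objects; NE2⁺ is NOT PRINTED for those and not proved; NOT a node discharge; nothing continuum ∕ ℝ⁴ ∕ OS ∕ mass-gap
∕ Clay.  0 `sorry`, 0 `def`, standard axioms.

THE POINT.  King states Prop. 3.7 «for 0 ≤ j ≤ k − 1 and 0 < α < 1» with `C` generic: the gradient Hölder clause carries `C = C(α)` (the tree's letters:
`King1986/MinimizerHolderDecayUniform.holder_dkernel_decay_blocks_unif` with `δ = (1−α)∕(1+α)·δ₀`, this seat's part U-iv `ksDSlice_holder_unif`, [Ba 4] (1.9)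
`fineOp_inv_deriv_holder_decay_unif`), and in the model no α-uniform constant exists (`∇ℋ_j` is log-Lipschitz at block edges) — whence the lit-balaban leaf
`SlicePropagatorStatementsAt` v1.1 `Prop37PrintedAt α`∕`Prop37KingOrder` (16:52Z 08-28, on this seat's schema note).  THIS FILE transports the two per-`α`
letters to the one carrier of parts Ρ-a∕Ρ-c: the weight `(|x − x′|∕N)^{−α}` is the carrier's `(|x−y|_{T_η}∕L^j)^{−α}` (`tdistT_torCongr`), the two-source block
decay `e^{−δ|B(x)−B(z)|} + e^{−δ|B(y)−B(z)|}` is `≤ 2e^{δ}·e^{−δ·min(|x−z|, |y−z|)∕L^j}` (part Ρ-a `exp_sliceBlockDist_le`).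
* §1 `le_mul_rpow_of_rpow_neg_mul_le` (a weight `w^{−α}`, `w > 0`, moved to the right), ★★ **`kingSliceDG_holder_le_at`** ((3.65)₂ at fixed `α`, slices `j ≥ 1`:
  `|ksDSlice_μ(x, z) − ksDSlice_μ(y, z)| ≤ C·(|x−y|∕L^j)^α·e^{−δ₀·min(|x−z|,|y−z|)∕L^j}` on the carrier, ONE `(C(α), δ₀(α))` ∀ masses ≤ m₀² ∀ levels ∀ volumes);
* §2 ★★ **`kingSliceZero_dholder_le_at`** ((3.65)₂ at fixed `α`, `j = 0`: the forward differences of the one-step covariance's entries,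
  `≤ C·|x−y|^α·e^{−δ₀·min(|x−z|,|y−z|)}`).
WHAT THE CURVED CASE ADDS (one line): (3.65) for `G(Ω, A)` with a regular background — [Ba 4]'s (1.9) with `A ≠ 0`, sub-domains.
HONEST SCOPE.  (i) `A = 0`, periodic b.c., odd `L ≥ 3`, `0 < m² ≤ m₀²`, `0 < α < 1` FIXED (constants depend on `α`); (ii) lattice units (King's `(L^jη)^{1−D−α}` is the
by-name file's bookkeeping); (iii) not Bałaban's `G(Ω, A)`; not a discharge.
Locators: [King1986] (3.62) p.663, Prop. 3.7 (3.65) p.663, Theorem 3.3 (3.8) p.656; [Balaban1983RegularityDecay] Theorem (1.9) p.573.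
-/

noncomputable section

namespace Summit.QuantumFields.YangMills.BalabanUVNodes.N15KingModelRung.Curved

open Real Finset Matrix
open Literature.MathematicalPhysics.QuantumFieldTheory.Balaban1983to89 (Params)
open Literature.MathematicalPhysics.QuantumFieldTheory.Balaban1983to89.B5Prop11Plancherel (Tor fine unitVec)
open Literature.MathematicalPhysics.QuantumFieldTheory.King1986 (aK aK_pos aK_le)
open Literature.MathematicalPhysics.QuantumFieldTheory.King1986.Torus (fineOp blockOf tdistT tdistT_nonneg tdistT_triangle tdistT_symm tdistT_self
  torCongr torCongr_add torCongr_unitVec tdistT_torCongr fineOp_inv_deriv_holder_decay_unif)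

variable {d : ℕ} (L : ℕ) [NeZero L]

/-! ## §1 The gradient Hölder clause at fixed `α`, slices `j ≥ 1` -/

omit [NeZero L] in
/-- Bookkeeping: a bound `w^{−α}·X ≤ B` with `w > 0` reads `X ≤ w^{α}·B`. [folklore] -/
theorem le_mul_rpow_of_rpow_neg_mul_le {w α X B : ℝ} (hw : 0 < w) (h : w ^ (-α) * X ≤ B) : X ≤ w ^ α * B := by
  have hwα : 0 < w ^ α := Real.rpow_pos_of_pos hw α
  have hmul := mul_le_mul_of_nonneg_left h hwα.le
  rwa [← mul_assoc, ← Real.rpow_add hw, add_neg_cancel, Real.rpow_zero, one_mul] at hmul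

/-- ★★ **(3.65)₂ AT FIXED `α`, SLICES `j ≥ 1`, ON THE CARRIER** (lattice units): for `0 < α < 1` there are `C, δ₀ > 0` such that for every mass
`0 < m² ≤ m₀²`, level `k`, volume, index `i` on the carrier (`h`), direction `μ`, and fine points `x ≠ y`, `z`:
`|ksDSlice_μ(x, z) − ksDSlice_μ(y, z)| ≤ C·(|x−y|_{T_η}∕L^j)^α·e^{−δ₀·min(|x−z|,|y−z|)∕L^j}` — part U-iv `ksDSlice_holder_unif` (King's (3.65) for `∂^η_μℋ_j` inside
the three-factor piece) read through `torCongr`. [cite: King1986, Prop. 3.7 (3.65) p.663 (second Hölder display), (3.62) p.663] -/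
theorem kingSliceDG_holder_le_at (hLodd : Odd L) (hL : 2 ≤ L) {a : ℝ} (ha : 0 < a) {m0sq : ℝ} (hm0 : 0 ≤ m0sq) {α : ℝ} (hα0 : 0 < α)
    (hα1 : α < 1) :
    ∃ C δ₀ : ℝ, 0 < C ∧ 0 < δ₀ ∧ ∀ (m2 : ℝ), 0 < m2 → m2 ≤ m0sq →
      ∀ (k : ℕ) (M : Fin (d + 1) → ℕ) [∀ μ, NeZero (M μ)] (i : KSliceIdx d) (h : ∀ μ, fine (L ^ k) M μ = fine (L ^ i.j) (ksU L i) μ)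
        (μ : Fin (d + 1)) (x y z : Tor (fine (L ^ k) M)), 0 < tdistT (fine (L ^ k) M) x y →
        |ksDSlice L a m2 i μ (torCongr h x) (torCongr h z) - ksDSlice L a m2 i μ (torCongr h y) (torCongr h z)|
          ≤ C * (tdistT (fine (L ^ k) M) x y / (L : ℝ) ^ i.j) ^ α
              * Real.exp (-(δ₀ * (min (tdistT (fine (L ^ k) M) x z) (tdistT (fine (L ^ k) M) y z) / (L : ℝ) ^ i.j))) := by
  obtain ⟨C, δ, hC, hδ, H⟩ := ksDSlice_holder_unif (d := d) L hLodd hL ha hm0 hα0 hα1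
  refine ⟨2 * Real.exp δ * C, δ, by positivity, hδ, ?_⟩
  intro m2 hm hcap k M _ i h μ x y z hxy
  have hL0 : (0 : ℝ) < L := by exact_mod_cast Nat.pos_of_ne_zero (NeZero.ne L)
  have hℓ : (0 : ℝ) < (L : ℝ) ^ i.j := pow_pos hL0 _
  have hw : 0 < tdistT (fine (L ^ k) M) x y / (L : ℝ) ^ i.j := div_pos hxy hℓ
  have h1 := H m2 hm hcap i μ (torCongr h y) (torCongr h x) (torCongr h z)
  rw [tdistT_torCongr h, tdistT_symm, Nat.cast_pow] at h1
  -- the two-source block decay against the fine `min`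
  set m : ℝ := min (tdistT (fine (L ^ k) M) x z) (tdistT (fine (L ^ k) M) y z) with hm
  have hex : ∀ {w : Tor (fine (L ^ k) M)}, m ≤ tdistT (fine (L ^ k) M) w z →
      Real.exp (-(δ * tdistT (ksU L i) (blockOf (L ^ i.j) (ksU L i) (torCongr h w)) (blockOf (L ^ i.j) (ksU L i) (torCongr h z))))
        ≤ Real.exp δ * Real.exp (-(δ * (m / (L : ℝ) ^ i.j))) := by
    intro w hmw
    refine (exp_sliceBlockDist_le L i M h hδ.le w z).trans (mul_le_mul_of_nonneg_left (Real.exp_le_exp.mpr ?_) (Real.exp_nonneg _))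
    have := div_le_div_of_nonneg_right hmw hℓ.le
    nlinarith
  have h2 : (tdistT (fine (L ^ k) M) x y / (L : ℝ) ^ i.j) ^ (-α)
      * |ksDSlice L a m2 i μ (torCongr h x) (torCongr h z) - ksDSlice L a m2 i μ (torCongr h y) (torCongr h z)|
        ≤ 2 * Real.exp δ * C * Real.exp (-(δ * (m / (L : ℝ) ^ i.j))) := by
    refine h1.trans ?_
    calc C * (Real.exp (-(δ * tdistT (ksU L i) (blockOf (L ^ i.j) (ksU L i) (torCongr h y)) (blockOf (L ^ i.j) (ksU L i) (torCongr h z))))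
          + Real.exp (-(δ * tdistT (ksU L i) (blockOf (L ^ i.j) (ksU L i) (torCongr h x)) (blockOf (L ^ i.j) (ksU L i) (torCongr h z)))))
        ≤ C * (Real.exp δ * Real.exp (-(δ * (m / (L : ℝ) ^ i.j))) + Real.exp δ * Real.exp (-(δ * (m / (L : ℝ) ^ i.j)))) :=
          mul_le_mul_of_nonneg_left (add_le_add (hex (min_le_right _ _)) (hex (min_le_left _ _))) hC.le
      _ = 2 * Real.exp δ * C * Real.exp (-(δ * (m / (L : ℝ) ^ i.j))) := by ring
  have h3 := le_mul_rpow_of_rpow_neg_mul_le hw h2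
  calc _ ≤ _ := h3
    _ = _ := by ring

/-! ## §2 The gradient Hölder clause at fixed `α`, the finest slice `j = 0` -/

/-- ★★ **(3.65)₂ AT FIXED `α`, `j = 0`, ON THE CARRIER**: for `0 < α < 1` there are `C, δ₀ > 0` such that for every mass `0 < m² ≤ m₀²`, `k ≥ 1`, volumes
`M`, `M′_ν = 2L^{e_M+k−1}`, period identity `h0`, direction `μ` and fine points `x ≠ y`, `z`, the forward differences of the one-step covariance's entries
`C(w) := (fineOp L^1 M′ a_1 (L^1)² m²)⁻¹(w, z)` satisfy `|L(C(x+e_μ) − C(x)) − L(C(y+e_μ) − C(y))| ≤ C·|x−y|_{T_η}^α·e^{−δ₀·min(|x−z|, |y−z|)}` — [Ba 4]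
(1.9) at `K = 1` (`fineOp_inv_deriv_holder_decay_unif`) on the point source `δ_z`, block distance of the `L`-blocks `≥ |·|∕L − 1`.
[cite: King1986, Prop. 3.7 (3.65) p.663 (j = 0), Theorem 3.3 (3.8) p.656; Balaban1983RegularityDecay, Theorem (1.9) p.573] -/
theorem kingSliceZero_dholder_le_at (hLodd : Odd L) (hL : 2 ≤ L) {a : ℝ} (ha : 0 < a) {m0sq : ℝ} (hm0 : 0 ≤ m0sq) {α : ℝ} (hα0 : 0 < α)
    (hα1 : α < 1) :
    ∃ C δ₀ : ℝ, 0 < C ∧ 0 < δ₀ ∧ ∀ (msq : ℝ), 0 < msq → msq ≤ m0sq →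
      ∀ (k eM : ℕ) (M : Fin (d + 1) → ℕ) [∀ μ, NeZero (M μ)] (M' : Fin (d + 1) → ℕ) [∀ μ, NeZero (M' μ)], (∀ μ, M' μ = 2 * L ^ (eM + k - 1)) →
      ∀ (h0 : ∀ μ, fine (L ^ k) M μ = fine (L ^ 1) M' μ) (μ : Fin (d + 1)) (x y z : Tor (fine (L ^ k) M)), 0 < tdistT (fine (L ^ k) M) x y →
        |(L : ℝ) * ((fineOp (L ^ 1) M' (aK a L 1) (((L ^ 1 : ℕ) : ℝ) ^ 2) msq)⁻¹ (torCongr h0 (x + unitVec (fine (L ^ k) M) μ)) (torCongr h0 z)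
              - (fineOp (L ^ 1) M' (aK a L 1) (((L ^ 1 : ℕ) : ℝ) ^ 2) msq)⁻¹ (torCongr h0 x) (torCongr h0 z))
          - (L : ℝ) * ((fineOp (L ^ 1) M' (aK a L 1) (((L ^ 1 : ℕ) : ℝ) ^ 2) msq)⁻¹ (torCongr h0 (y + unitVec (fine (L ^ k) M) μ)) (torCongr h0 z)
              - (fineOp (L ^ 1) M' (aK a L 1) (((L ^ 1 : ℕ) : ℝ) ^ 2) msq)⁻¹ (torCongr h0 y) (torCongr h0 z))|
          ≤ C * (tdistT (fine (L ^ k) M) x y) ^ α * Real.exp (-(δ₀ * min (tdistT (fine (L ^ k) M) x z) (tdistT (fine (L ^ k) M) y z))) := by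
  classical
  have hL1 : 1 < L := by omega
  have hL0 : (0 : ℝ) < L := by exact_mod_cast Nat.pos_of_ne_zero (NeZero.ne L)
  have hL1r : (1 : ℝ) ≤ L := by exact_mod_cast hL1.le
  obtain ⟨δ, c, hδ, hc, H⟩ := fineOp_inv_deriv_holder_decay_unif (d + 1) L (by omega) ⟨hLodd, hL1⟩ ha hm0 hα0.le hα1
  refine ⟨c * Real.exp δ, δ / L, by positivity, div_pos hδ hL0, ?_⟩
  intro msq hmsq hcap k eM M _ M' _ hM' h0 μ x y z hxy
  have e1 : ((L ^ 1 : ℕ) : ℝ) = L := by push_cast; ring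
  rw [e1]
  set x' := torCongr h0 x with hx'
  set y' := torCongr h0 y with hy'
  set z' := torCongr h0 z with hz'
  set P : Params := ⟨d + 1, L, eM + k - 1, 1, by omega, ⟨hLodd, hL1⟩⟩ with hP
  have hMK : ∀ ν, M' ν = P.sitesPerDir P.K := fun ν => by rw [hM' ν]; simp [hP, Params.sitesPerDir]
  set D : ℝ := min (tdistT M' (blockOf (L ^ 1) M' x') (blockOf (L ^ 1) M' z')) (tdistT M' (blockOf (L ^ 1) M' y') (blockOf (L ^ 1) M' z')) with hD
  have hne : y' ≠ x' := by
    intro hxy'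
    have : tdistT (fine (L ^ k) M) x y = 0 := by
      rw [← tdistT_torCongr h0, ← hx', ← hy', hxy', tdistT_self]
    exact hxy.ne' this
  have h1 := H P rfl rfl le_rfl msq hmsq.le hcap M' hMK (L ^ 1) (by simp [hP]) (Pi.single z' 1) 1 D
    (fun w => by by_cases hw : w = z' <;> simp [hw]) x' y' hne
    (fun w hw => by rw [show w = z' from Classical.byContradiction fun hn => hw (by simp [hn])]; exact min_le_left _ _)
    (fun w hw => by rw [show w = z' from Classical.byContradiction fun hn => hw (by simp [hn])]; exact min_le_right _ _) μ
  -- read the point source, the shifts and the weight on the carrier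
  simp only [Matrix.mulVec_single_one, Matrix.col_apply] at h1
  rw [show x' + unitVec (fine (L ^ 1) M') μ = torCongr h0 (x + unitVec (fine (L ^ k) M) μ) by rw [hx', torCongr_add, torCongr_unitVec],
    show y' + unitVec (fine (L ^ 1) M') μ = torCongr h0 (y + unitVec (fine (L ^ k) M) μ) by rw [hy', torCongr_add, torCongr_unitVec],
    hx', hy', tdistT_torCongr h0, mul_one, e1] at h1
  -- `|a − b| = |b − a|`
  rw [abs_sub_comm] at h1
  -- the block `min` against the fine `min`
  have hDge : min (tdistT (fine (L ^ k) M) x z) (tdistT (fine (L ^ k) M) y z) / L - 1 ≤ D := by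
    have hb : ∀ w : Tor (fine (L ^ k) M), tdistT (fine (L ^ k) M) w z / L - 1 ≤ tdistT M' (blockOf (L ^ 1) M' (torCongr h0 w)) (blockOf (L ^ 1) M' z') := by
      intro w
      have hfb := tdistT_fine_le_blocks (L ^ 1) M' (torCongr h0 w) z'
      rw [hz', tdistT_torCongr h0] at hfb
      push_cast at hfb; rw [pow_one] at hfb
      rw [sub_le_iff_le_add, div_le_iff₀ hL0]
      nlinarith [tdistT_nonneg M' (blockOf (L ^ 1) M' (torCongr h0 w)) (blockOf (L ^ 1) M' z')]
    rw [hD]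
    refine le_min ?_ ?_
    · exact ((sub_le_sub_right (div_le_div_of_nonneg_right (min_le_left _ _) hL0.le) 1).trans (hb x))
    · exact ((sub_le_sub_right (div_le_div_of_nonneg_right (min_le_right _ _) hL0.le) 1).trans (hb y))
  have hexp : Real.exp (-(δ * D)) ≤ Real.exp δ * Real.exp (-(δ / L * min (tdistT (fine (L ^ k) M) x z) (tdistT (fine (L ^ k) M) y z))) := by
    rw [← Real.exp_add]
    refine Real.exp_le_exp.mpr ?_
    have := mul_le_mul_of_nonneg_left hDge hδ.le
    have e : δ * (min (tdistT (fine (L ^ k) M) x z) (tdistT (fine (L ^ k) M) y z) / ↑L - 1)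
        = δ / L * min (tdistT (fine (L ^ k) M) x z) (tdistT (fine (L ^ k) M) y z) - δ := by field_simp
    linarith
  have h2 : (tdistT (fine (L ^ k) M) x y / L) ^ (-α) * _ ≤ c * Real.exp δ
      * Real.exp (-(δ / L * min (tdistT (fine (L ^ k) M) x z) (tdistT (fine (L ^ k) M) y z))) :=
    h1.trans (by rw [mul_assoc]; exact mul_le_mul_of_nonneg_left hexp hc.le)
  have hw : 0 < tdistT (fine (L ^ k) M) x y / L := div_pos hxy hL0
  have h3 := le_mul_rpow_of_rpow_neg_mul_le hw h2
  -- `(t∕L)^α ≤ t^α`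
  have hwα : (tdistT (fine (L ^ k) M) x y / L) ^ α ≤ (tdistT (fine (L ^ k) M) x y) ^ α :=
    Real.rpow_le_rpow hw.le (div_le_self hxy.le hL1r) hα0.le
  refine h3.trans ?_
  have hB : 0 ≤ c * Real.exp δ * Real.exp (-(δ / L * min (tdistT (fine (L ^ k) M) x z) (tdistT (fine (L ^ k) M) y z))) := by positivity
  calc (tdistT (fine (L ^ k) M) x y / ↑L) ^ α * (c * Real.exp δ * Real.exp (-(δ / ↑L * min (tdistT (fine (L ^ k) M) x z) (tdistT (fine (L ^ k) M) y z))))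
      ≤ (tdistT (fine (L ^ k) M) x y) ^ α * (c * Real.exp δ * Real.exp (-(δ / ↑L * min (tdistT (fine (L ^ k) M) x z) (tdistT (fine (L ^ k) M) y z)))) :=
        mul_le_mul_of_nonneg_right hwα hB
    _ = _ := by ring

end Summit.QuantumFields.YangMills.BalabanUVNodes.N15KingModelRung.Curved

end
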